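import Summits.Ventures.QEC.Basic.HypergraphProduct
import Literature.InformationTheory.QuantumCodes.HypergraphProductParameters

/-!
# Parameters of `HGP(H₁, H₂)`: dimension and minimum distance — PROVED (venture-side corollaries)

LADDER-QEC (venture cell `qec`, PARTITION row type-04), `Summits/Ventures/QEC/Basic/`. The instance-level
statements the census / search seats use for the hypergraph product `HGP(H₁,H₂)` of
`Summits.Ventures.QEC.Basic.HypergraphProduct` (`HX = [H₁ ⊗ 1 | 1 ⊗ H₂ᵀ]`, `HZ = [1 ⊗ H₂ | H₁ᵀ ⊗ 1]`), all
PROVED from the Literature-side proofs of Tillich–Zémor's Theorem 7, Theorem 9 and Lemma 10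
(`Literature.InformationTheory.QuantumCodes.HypergraphProduct{Dimension,Distance,Parameters}`,
[TillichZemor2014]) through the dictionary `HGP(H₁,H₂) = Q_{ℋ₁·ℋ₂ᵀ}`:

* `HGP.k_eq` — `n₁n₂ + m₁m₂ − rank HX − rank HZ = k₁k₂ + k₁ᵀk₂ᵀ` (`kᵢ = dim ker Hᵢ`, `kᵢᵀ = dim ker Hᵢᵀ`);
* `HGP.distance_ge` — `D ≥ min(d₁, d₂, d₁ᵀ, d₂ᵀ)` (`dᵢ = d(ker Hᵢ)`, `dᵢᵀ = d(ker Hᵢᵀ)`, `⊤` for a zero code);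
* `HGP.distance_eq_min` — if `H₁`, `H₂` have linearly independent rows (`rank Hᵢ = mᵢ`) and `k₁, k₂ ≥ 1` then
  `D = min(d₁, d₂)`: the `[[n₁n₂ + r₁r₂, k₁k₂, min{d₁,d₂}]]` statement of Breuckmann–Eberhardt 2021 §4.1
  [BreuckmannEberhardt2021] (with its hypothesis "`rᵢ` linearly independent checks" and the implicit
  `kᵢ ≥ 1`; without logical qubits `D = ⊤`).

HONEST FRAMING: these are theorems about ALL pairs of binary matrices; they certify no distance of a
specific code (census rows come from certificates). `D` is the CSS minimum distance
`Literature.InformationTheory.QuantumCodes.cssMinDist` (minimum weight of `ker HX ∖ rowsp HZ ∪ ker HZ ∖ rowsp HX`,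
an `ℕ∞`), the notion the named facts are stated in; the bridge to row type-02's stabilizer-formalism
`distance` is type-02's `CSS.distance_eq_min_dX_dZ` lemma, not this file.
-/

namespace Summit.Ventures.QEC.HGP

open Matrix Module
open scoped Kronecker
open Literature.InformationTheory.QuantumCodes
open Literature.InformationTheory.Coding (minDist minDist_bot minDist_le_hammingNorm)

variable {m₁ n₁ m₂ n₂ : ℕ}

/-- A parity-check matrix with linearly independent rows has no transpose code: `ker Hᵀ = 0`.
[cite: TillichZemor2014, §6 (arXiv v1 chunk p0009 L8-10: "a full-rank parity-check matrix means that `dim Z(ℋ₁ᵀ) = 0`")] -/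
theorem pcCode_transpose_eq_bot_of_rank {m n : ℕ} (H : Matrix (Fin m) (Fin n) (ZMod 2)) (hH : H.rank = m) :
    pcCode Hᵀ = ⊥ := by
  have h := HypergraphProduct.rank_add_finrank_pcCode Hᵀ
  rw [Matrix.rank_transpose, hH, Fintype.card_fin] at h
  exact Submodule.finrank_eq_zero.1 (by omega)

/-- A code with a logical bit has finite minimum distance. [cite: TillichZemor2014, §5 (arXiv v1 chunk p0008 L3-4: the convention `d(0) = ∞`)] -/
theorem minDist_lt_top_of_finrank_pos {m n : ℕ} (H : Matrix (Fin m) (Fin n) (ZMod 2))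
    (hk : 0 < finrank (ZMod 2) (pcCode H)) : minDist (pcCode H) < ⊤ := by
  obtain ⟨c, hc⟩ := Module.finrank_pos_iff_exists_ne_zero.1 hk
  have h := minDist_le_hammingNorm c.2 (fun h0 => hc (Subtype.ext h0))
  exact lt_of_le_of_lt h (ENat.coe_lt_top _)

/-- **Dimension of `HGP(H₁,H₂)`, proved**: the number of logical qubits
`n₁n₂ + m₁m₂ − rank H_X − rank H_Z` equals `k₁k₂ + k₁ᵀk₂ᵀ` (`kᵢ = dim ker Hᵢ`, `kᵢᵀ = dim ker Hᵢᵀ`), over `ℤ`.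
Tillich–Zémor Theorem 7 for `ℋ₁·ℋ₂ᵀ` (`k = k₁`, `r = k₁ᵀ`, `h = k₂ᵀ`, `s = k₂`) plus rank–nullity.
[cite: TillichZemor2014, Thm 7 (arXiv v1 chunk p0007 L126-135)] -/
theorem k_eq (H₁ : Matrix (Fin m₁) (Fin n₁) (ZMod 2)) (H₂ : Matrix (Fin m₂) (Fin n₂) (ZMod 2)) :
    (n₁ * n₂ + m₁ * m₂ : ℤ) - (HX H₁ H₂).rank - (HZ H₁ H₂).rank
      = (finrank (ZMod 2) (pcCode H₁) : ℤ) * finrank (ZMod 2) (pcCode H₂)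
        + (finrank (ZMod 2) (pcCode H₁ᵀ) : ℤ) * finrank (ZMod 2) (pcCode H₂ᵀ) := by
  obtain ⟨-, hF⟩ := HypergraphProduct.dimension_eq_holds (Fin m₁) (Fin n₁) (Fin n₂) (Fin m₂) H₁ H₂ᵀ
  simp only [Fintype.card_sum, Fintype.card_prod, Fintype.card_fin] at hF
  have A1 := HypergraphProduct.rank_add_finrank_pcCode H₁
  have A1t := HypergraphProduct.rank_add_finrank_pcCode H₁ᵀ
  have A2 := HypergraphProduct.rank_add_finrank_pcCode H₂
  have A2t := HypergraphProduct.rank_add_finrank_pcCode H₂ᵀ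
  rw [Matrix.rank_transpose] at A1t A2t
  simp only [Fintype.card_fin] at A1 A1t A2 A2t
  have B1 : (H₁.rank : ℤ) + finrank (ZMod 2) (pcCode H₁) = n₁ := by exact_mod_cast A1
  have B1t : (H₁.rank : ℤ) + finrank (ZMod 2) (pcCode H₁ᵀ) = m₁ := by exact_mod_cast A1t
  have B2 : (H₂.rank : ℤ) + finrank (ZMod 2) (pcCode H₂) = n₂ := by exact_mod_cast A2
  have B2t : (H₂.rank : ℤ) + finrank (ZMod 2) (pcCode H₂ᵀ) = m₂ := by exact_mod_cast A2t
  push_cast at hF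
  rw [HX, HZ]
  linear_combination hF + (finrank (ZMod 2) (pcCode H₁) : ℤ) * (B2t - B2)
    + (finrank (ZMod 2) (pcCode H₂ᵀ) : ℤ) * (B1 - B1t)

/-- **Minimum distance of `HGP(H₁,H₂)`, lower bound, proved**: the CSS minimum distance `D` of `(H_X, H_Z)`
satisfies `D ≥ min(d₁, d₂, d₁ᵀ, d₂ᵀ)` (`dᵢ = d(ker Hᵢ)`, `dᵢᵀ = d(ker Hᵢᵀ)`). Tillich–Zémor Theorem 9 for
`ℋ₁·ℋ₂ᵀ`. [cite: TillichZemor2014, Thm 9 (arXiv v1 chunk p0008 L11-15)] -/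
theorem distance_ge (H₁ : Matrix (Fin m₁) (Fin n₁) (ZMod 2)) (H₂ : Matrix (Fin m₂) (Fin n₂) (ZMod 2)) :
    min (min (minDist (pcCode H₁)) (minDist (pcCode H₂)))
        (min (minDist (pcCode H₁ᵀ)) (minDist (pcCode H₂ᵀ)))
      ≤ cssMinDist (HX H₁ H₂) (HZ H₁ H₂) := by
  have h := HypergraphProduct.minDist_ge_holds (Fin m₁) (Fin n₁) (Fin n₂) (Fin m₂) H₁ H₂ᵀ
  rw [Matrix.transpose_transpose] at h
  refine le_trans (le_of_eq ?_) h
  ac_rfl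

/-- **Minimum distance of `HGP(H₁,H₂)`, full-rank case, proved**: if `H₁` and `H₂` have linearly independent
rows and both classical codes have a logical bit (`dim ker Hᵢ ≥ 1`), then `D = min(d₁, d₂)` — "The hypergraph
product constructs a `[[n₁n₂ + r₁r₂, k₁k₂, min{d₁,d₂}]]` quantum code from two classical `[nᵢ,kᵢ,dᵢ]`-codes
with `rᵢ` linearly independent checks". `≥`: TZ Thm 9 (`d₁ᵀ = d₂ᵀ = ∞`); `≤ d₁`: TZ Lemma 10 for `ℋ₁·ℋ₂ᵀ`;
`≤ d₂`: TZ Lemma 10 for the Poincaré dual `ℋ₁ᵀ·ℋ₂` (`cssMinDist_transpose`).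
[cite: BreuckmannEberhardt2021, §4.1 (arXiv chunk p0009 L21)] -/
theorem distance_eq_min (H₁ : Matrix (Fin m₁) (Fin n₁) (ZMod 2)) (H₂ : Matrix (Fin m₂) (Fin n₂) (ZMod 2))
    (hH₁ : H₁.rank = m₁) (hH₂ : H₂.rank = m₂)
    (hk₁ : 0 < finrank (ZMod 2) (pcCode H₁)) (hk₂ : 0 < finrank (ZMod 2) (pcCode H₂)) :
    cssMinDist (HX H₁ H₂) (HZ H₁ H₂) = min (minDist (pcCode H₁)) (minDist (pcCode H₂)) := by
  have hd₁ := minDist_lt_top_of_finrank_pos H₁ hk₁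
  have hd₂ := minDist_lt_top_of_finrank_pos H₂ hk₂
  refine le_antisymm (le_min ?_ ?_) ?_
  · -- `D ≤ d₁`: Lemma 10 (first clause) for `ℋ₁·ℋ₂ᵀ`
    refine (HypergraphProduct.minDist_le_holds (Fin m₁) (Fin n₁) (Fin n₂) (Fin m₂) H₁ H₂ᵀ).1 hd₁ ?_
    rwa [Matrix.transpose_transpose]
  · -- `D ≤ d₂`: Lemma 10 (second clause) for the dual hypergraph `ℋ₁ᵀ·ℋ₂`
    rw [HX, HZ, ← HypergraphProduct.cssMinDist_transpose, Matrix.transpose_transpose]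
    refine (HypergraphProduct.minDist_le_holds (Fin n₁) (Fin m₁) (Fin m₂) (Fin n₂) H₁ᵀ H₂).2 hd₂ ?_
    rwa [Matrix.transpose_transpose]
  · -- `D ≥ min(d₁,d₂)`: Theorem 9 with `ker H₁ᵀ = ker H₂ᵀ = 0`
    have h := distance_ge H₁ H₂
    rw [pcCode_transpose_eq_bot_of_rank H₁ hH₁, pcCode_transpose_eq_bot_of_rank H₂ hH₂] at h
    simpa only [minDist_bot, min_self, min_top_right] using h

end Summit.Ventures.QEC.HGP
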